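/-
Copyright (c) 2026 the pub-hodgecm-mathlib formalisation cell (harness21).  Prover seat hodgecm-mathlib-LH4-p07 (g9), req620 Track A «(D-RAM) FOUR-FRAME» squad
(STAGE-1b, row-(2) lineage; dealer LH4-plan (g13) WORD #58 RULING A ∕ #69 (4): owner of the two-literal census law of `lev_{a,m}`), 2026-09-04.
-/
import Mathlib.Tactic
import HarnessLib

/-!
# Crux `H413`, line LH4 «(D-RAM) FOUR-FRAME» — STAGE-1b, row (2): (LAW-exponents) «THE GENERAL (ks, T) RULE OF THE LEVEL LAW, AS ℕ IDENTITIES»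

Cell `hodgecm-mathlib` (D-0151), FLOOR 0, crux item H413 = `stmt-HodgeConjecture-24833`, route of record `HCCMUnconditional`; squad F0∕P3c∕LH4; lane
`--supports stmt-HodgeConjecture-24833 --as helper` (count-neutral; pays NO tier-0 row).  THEOREMS ONLY; pure `ℕ` bookkeeping (parity witnesses + `omega`).
OWNER'S ORGAN №13: the exponent side-goals of ★ p859957 `law_arith` for a GENERIC piece `(a, b, ks, T)` under LAW-INSTANCES v1's general rule
(`F0/P3c/LH4/LH4-p07/g9/LAW-INSTANCES.v1.LH4p07g9.md`; rows of record sq ∕ lev_lo ∕ lev_hi ∕ T₊-lo ∕ T₊-hi are instances), split by the parity lane of `a` —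
consumed by the RamK level socket `levelsCensusB` (SIG fc50d796) right before `law_arith`.  (`omega` alone does not close these in the socket's context: the floor
divisions of the weld's closed form need explicit parity witnesses — hence a separate, small file.)
HONEST LABEL.  Count-neutral arithmetic; `HC_CM` is proved only modulo the 7 printed citations (2 remaining named inputs: hLiu418 = `stmt-HodgeConjecture-24832`,
h413 = `stmt-HodgeConjecture-24833`) until rung 0 closes.

## References
* [Rogawski1990] J. D. Rogawski, *Automorphic Representations of Unitary Groups in Three Variables*, Ann. of Math. Stud. 123 (1990): §4.9 Prop. 4.9.1 (b) p. 55 (the constants of the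
  transfer identity these exponents feed).
-/

set_option autoImplicit false

namespace Summit.HodgeConjecture.HodgeConjecture.Cruxes.H413.F0P3cDyRamLevelsLawExponents
set_option maxHeartbeats 800000 in
-- budget only: sixteen `omega` calls over parity witnesses (no search); default 200000 covers one parity case.
/-- **THE LAW'S EXPONENT BOOKKEEPING, STANDARD LANE (`a` even).**  From the parities `jλ ≡ m ≡ d (2)`, the piece letters `d + 2a ≤ b + 1`, `b ≤ m`, the cutoff
`C = m + jλ − b`, the Eisenstein level `(jλ − d)∕2 = n` and the GENERAL RULE `2ks + 2⌊(d + a%2)∕2⌋ = a + a%2 + b + b%2`, `T + a = ks + (d − d%2)`: the four exponent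
identities ★ p859957 `law_arith` consumes at `(k, M, A, B, J, L, U, N, P) := (ks, m − a, (jλ−a−d)∕2 + 1, d − d%2, (jλ−a)∕2, (C + (m−a) − (jλ−a))∕2, (2(m−a)+1−d)∕2, m, n)`.
[cite: Rogawski1990, §4.9 Prop. 4.9.1 (b) p. 55] -/
theorem exponents_std {a b d ks T m jl n C : ℕ} (hjlpar : jl % 2 = d % 2) (hmpar : m % 2 = d % 2) (hmjl : m ≤ jl)
    (hab1 : d + 2 * a ≤ b + 1) (hbm : b ≤ m) (hd2 : 2 ≤ d) (hC : C = m + jl - b) (hn : (jl - d) / 2 + 1 = n + 1) (ha2 : a % 2 = 0)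
    (hks : 2 * ks + 2 * ((d + a % 2) / 2) = a + a % 2 + (b + b % 2)) (hT : a % 2 = 0 → T + a = ks + (d - d % 2))
    (hdjl : d + a ≤ jl) :
    (C + (m - a) - (jl - a)) / 2 ≤ (2 * (m - a) + 1 - d) / 2 ∧
      (m - a) + (((jl - a) - d) / 2 + 1) = (jl - a) / 2 + ((2 * (m - a) + 1 - d) / 2 + 1) ∧
      ks + ((jl - a) / 2 + ((C + (m - a) - (jl - a)) / 2 + 1)) = m + (n + 1) ∧
      ks + ((m - a) + (d - d % 2)) = m + T := by
  have hT' := hT ha2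
  obtain ⟨a2, rfl⟩ : ∃ a2, a = 2 * a2 := ⟨a / 2, by omega⟩
  rcases Nat.even_or_odd' d with ⟨d2, rfl | rfl⟩ <;> rcases Nat.even_or_odd' b with ⟨b2, rfl | rfl⟩
  · obtain ⟨m2, rfl⟩ : ∃ m2, m = 2 * m2 := ⟨m / 2, by omega⟩
    obtain ⟨j2, rfl⟩ : ∃ j2, jl = 2 * j2 := ⟨jl / 2, by omega⟩
    exact ⟨by omega, by omega, by omega, by omega⟩
  · obtain ⟨m2, rfl⟩ : ∃ m2, m = 2 * m2 := ⟨m / 2, by omega⟩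
    obtain ⟨j2, rfl⟩ : ∃ j2, jl = 2 * j2 := ⟨jl / 2, by omega⟩
    exact ⟨by omega, by omega, by omega, by omega⟩
  · obtain ⟨m2, rfl⟩ : ∃ m2, m = 2 * m2 + 1 := ⟨m / 2, by omega⟩
    obtain ⟨j2, rfl⟩ : ∃ j2, jl = 2 * j2 + 1 := ⟨jl / 2, by omega⟩
    exact ⟨by omega, by omega, by omega, by omega⟩
  · obtain ⟨m2, rfl⟩ : ∃ m2, m = 2 * m2 + 1 := ⟨m / 2, by omega⟩
    obtain ⟨j2, rfl⟩ : ∃ j2, jl = 2 * j2 + 1 := ⟨jl / 2, by omega⟩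
    exact ⟨by omega, by omega, by omega, by omega⟩

set_option maxHeartbeats 800000 in
-- budget only: as above.
/-- **THE LAW'S EXPONENT BOOKKEEPING, FLIPPED LANE (`a` odd)**: the same with ★ p859944's flipped shapes `A = (jλ−a−d+1)∕2 + d%2`, `B = d − 1 + d%2` and the rule
`T + a + 1 = ks + (d − d%2) + 2(d%2)`. [cite: Rogawski1990, §4.9 Prop. 4.9.1 (b) p. 55] -/
theorem exponents_flip {a b d ks T m jl n C : ℕ} (hjlpar : jl % 2 = d % 2) (hmpar : m % 2 = d % 2) (hmjl : m ≤ jl)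
    (hab1 : d + 2 * a ≤ b + 1) (hbm : b ≤ m) (hd2 : 2 ≤ d) (hC : C = m + jl - b) (hn : (jl - d) / 2 + 1 = n + 1) (ha2 : a % 2 = 1)
    (hks : 2 * ks + 2 * ((d + a % 2) / 2) = a + a % 2 + (b + b % 2)) (hT : a % 2 = 1 → T + a + 1 = ks + (d - d % 2) + 2 * (d % 2))
    (hdjl : d + a ≤ jl) :
    (C + (m - a) - (jl - a)) / 2 ≤ (2 * (m - a) + 1 - d) / 2 ∧
      (m - a) + (((jl - a) - d + 1) / 2 + d % 2) = (jl - a) / 2 + ((2 * (m - a) + 1 - d) / 2 + 1) ∧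
      ks + ((jl - a) / 2 + ((C + (m - a) - (jl - a)) / 2 + 1)) = m + (n + 1) ∧
      ks + ((m - a) + (d - 1 + d % 2)) = m + T := by
  have hT' := hT ha2
  obtain ⟨a2, rfl⟩ : ∃ a2, a = 2 * a2 + 1 := ⟨a / 2, by omega⟩
  rcases Nat.even_or_odd' d with ⟨d2, rfl | rfl⟩ <;> rcases Nat.even_or_odd' b with ⟨b2, rfl | rfl⟩
  · obtain ⟨m2, rfl⟩ : ∃ m2, m = 2 * m2 := ⟨m / 2, by omega⟩
    obtain ⟨j2, rfl⟩ : ∃ j2, jl = 2 * j2 := ⟨jl / 2, by omega⟩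
    exact ⟨by omega, by omega, by omega, by omega⟩
  · obtain ⟨m2, rfl⟩ : ∃ m2, m = 2 * m2 := ⟨m / 2, by omega⟩
    obtain ⟨j2, rfl⟩ : ∃ j2, jl = 2 * j2 := ⟨jl / 2, by omega⟩
    exact ⟨by omega, by omega, by omega, by omega⟩
  · obtain ⟨m2, rfl⟩ : ∃ m2, m = 2 * m2 + 1 := ⟨m / 2, by omega⟩
    obtain ⟨j2, rfl⟩ : ∃ j2, jl = 2 * j2 + 1 := ⟨jl / 2, by omega⟩
    exact ⟨by omega, by omega, by omega, by omega⟩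
  · obtain ⟨m2, rfl⟩ : ∃ m2, m = 2 * m2 + 1 := ⟨m / 2, by omega⟩
    obtain ⟨j2, rfl⟩ : ∃ j2, jl = 2 * j2 + 1 := ⟨jl / 2, by omega⟩
    exact ⟨by omega, by omega, by omega, by omega⟩

end Summit.HodgeConjecture.HodgeConjecture.Cruxes.H413.F0P3cDyRamLevelsLawExponents
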